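import Literature.NumberTheory.Sieve.BombieriFriedlanderIwaniecTheorem9SwitchCounting
import Literature.NumberTheory.Sieve.BombieriFriedlanderIwaniecTheorem9Intervals
import Literature.NumberTheory.Sieve.BombieriFriedlanderIwaniecTheorem9Errors
import HarnessLib

/-!
# BFI 1986, Theorem 9 — the `q ↔ s` switch at the level of `Λ`, II: one cell of `(q, r)`

Topic `Literature/NumberTheory/Sieve`; continuation of `…Theorem9SwitchCounting` and
`…Theorem9Intervals`.  For one block `P < q ≤ P'` (`P' ≤ 2P`) of large moduli factors and one
block `R₀ < r ≤ λR₀` (`λ = 1 + η`) of the outer variable of Theorem 9 of E. Bombieri,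
J. B. Friedlander, H. Iwaniec, Acta Math. 156 (1986), 203–251, the signed sum
`∑_{r} δ_r ∑_{q, (q,a)=1} E(y; qr, a)` of balanced dyadic discrepancies of `Λ` is rewritten through
the complementary divisor `s = (n − a)/(qr)` (§13, p. 241: "`mn = a + qrs` … both `q` and `s` are
counted with weight 1 … `s` runs through an interval dependent on `m, n, r`.  By a subdivision
argument we remove this dependence with an admissible error term"):

* `BFI.swTrue` — the switched congruence sum at `(r, s)` (the range `P rs < n − a ≤ P' rs` of `n`
  depends on `r, s`); `BFI.sum_Ioc_ivlCongr_eq_sum_swTrue` — **the exact switch**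
  `∑_{P<q≤P'} ∑_{n ≡ a (qr)} Λ(n) = ∑_{s ≤ s_hi} swTrue(r, s)`, `s_hi = (2y − a)/(P R₀)`;
* the cells: `s` is cut into blocks `(S_j, λS_j]`, `S_j = s_hi λ^{−(j+1)}`, and on the cell
  `(R₀, λR₀] × (S_j, λS_j]` the range of `n` is replaced by the NOMINAL interval
  `(a + Pλ²R₀S_j, a + P'R₀S_j] ∩ (y, 2y]` (`BFI.cLo`, `BFI.cHi`), common to the cell and contained in
  every true range; the difference is supported on two layers of relative length `O(η)`
  (`BFI.layer_eq_sum`, `BFI.layer_le`: at most `log(2y)·(9ηP + 4)` per `(r, s)`);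
* the decomposition of the block sum (`BFI.blockSum_eq`):
  `∑_{q∈(P,P'],(q,a)=1} E(y; qr, a) = A(r) + (M^{sw}(r) − M(r)) + Err(r)`, where
  `A(r) = ∑_j ∑_{s ∈ (S_j,λS_j], (s,a)=1} discIvl(sr; nominal_j)` is a combination of interval
  discrepancies (to be bounded by the core dyadic-interval bound `BFI.IvlBoundAt`),
  `M(r) = ∑_q φ(qr)⁻¹ ∑_{(n,qr)=1} Λ(n)` and `M^{sw}(r)` its switched analogue (matched in the sequel),
  and `|Err(r)| ≤ E₁(r) + E₂(r) + Lay(r)` collects the moduli not coprime to `a` on either side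
  (`BFI.sum_notCoprime_ivlCongr_le`: only prime powers `p^k`, `p ∣ a`, are counted — `≪ y^{1/2}`)
  and the layers (`BFI.lay_le`: `Lay(r) ≤ 3λ y log(2y) (9η + 2/P)/r`).

Everything here is PROVED (finite combinatorics and the counting lemmas); no named fact is introduced.

## References

* E. Bombieri, J. B. Friedlander, H. Iwaniec, Acta Math. 156 (1986), 203–251: §13 p. 241–242,
  §16 p. 250. [BombieriFriedlanderIwaniecActa1986]
-/

open Finset Real
open scoped ArithmeticFunction.vonMangoldt ArithmeticFunction.sigma Chebyshev

namespace Literature.NumberTheory.Sieve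

namespace BFI

/-! ### The switched congruence sums -/

/-- The switched congruence sum at `(r, s)` for the `q`-block `(P, P']`:
`∑_{y<n≤2y, sr ∣ n−a, P rs < n−a ≤ P' rs} Λ(n)` — the `n` counted by the moduli `qr`, `P < q ≤ P'`,
whose complementary divisor is `s`. [cite: BombieriFriedlanderIwaniecActa1986, §13 p. 241–242] -/
noncomputable def swTrue (a : ℤ) (y P P' : ℝ) (r s : ℕ) : ℝ :=
  ∑ n ∈ Ioc ⌊y⌋₊ ⌊2 * y⌋₊,
    (if (y < (n : ℝ) ∧ (n : ℝ) ≤ 2 * y) ∧ ((s * r : ℕ) : ℤ) ∣ (n : ℤ) - a ∧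
        P * r * s < ((n : ℤ) - a : ℤ) ∧ (((n : ℤ) - a : ℤ) : ℝ) ≤ P' * r * s then (Λ n : ℝ) else 0)

/-- `swTrue ≥ 0`. [folklore] -/
theorem swTrue_nonneg (a : ℤ) (y P P' : ℝ) (r s : ℕ) : 0 ≤ swTrue a y P P' r s :=
  Finset.sum_nonneg fun n _ => by
    split_ifs
    · exact ArithmeticFunction.vonMangoldt_nonneg
    · exact le_rfl

/-- `ivlCongr` with the divisibility form of the congruence. [folklore] -/
theorem ivlCongr_eq_sum_dvd (d : ℕ) (a : ℤ) (c₁ c₂ y : ℝ) :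
    ivlCongr d a c₁ c₂ y = ∑ n ∈ Ioc ⌊y⌋₊ ⌊2 * y⌋₊,
      (if (c₁ < (n : ℝ) ∧ (n : ℝ) ≤ c₂) ∧ (d : ℤ) ∣ (n : ℤ) - a then (Λ n : ℝ) else 0) := by
  unfold ivlCongr
  refine Finset.sum_congr rfl fun n _ => ?_
  simp only [natCast_zmod_eq_iff_dvd]

/-- **The exact switch for one `r`**: for `a`, `y ≥ 1` with `|a| ≤ y`, `r > R₀ > 0`, `0 < P ≤ P'`,
`∑_{⌊P⌋ < q ≤ ⌊P'⌋} ivlCongr(qr; y, 2y) = ∑_{s ≤ ⌊s_hi⌋} swTrue(r, s)` with `s_hi = (2y − a)/(P R₀)`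
(beyond `s_hi` the range `P rs < n − a` leaves `(y, 2y]`).
[cite: BombieriFriedlanderIwaniecActa1986, §13 p. 241–242] -/
theorem sum_Ioc_ivlCongr_eq_sum_swTrue (a : ℤ) {y : ℝ} (hy : 1 ≤ y) (hay : |(a : ℝ)| ≤ y) {r : ℕ}
    {R₀ : ℝ} (hR₀ : 0 < R₀) (hr : R₀ < r) {P P' : ℝ} (hP : 0 < P) :
    ∑ q ∈ Ioc ⌊P⌋₊ ⌊P'⌋₊, ivlCongr (q * r) a y (2 * y) y =
      ∑ s ∈ Icc 1 ⌊(2 * y - a) / (P * R₀)⌋₊, swTrue a y P P' r s := by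
  have hr0 : 0 < r := by
    have : (0 : ℝ) < r := hR₀.trans hr
    exact_mod_cast this
  have hpos : ∀ n ∈ Ioc ⌊y⌋₊ ⌊2 * y⌋₊, a < (n : ℤ) := by
    intro n hn
    have hb := mem_Ioc_floor_bounds (zero_le_one.trans hy) hn
    have : (a : ℝ) < n := by linarith [le_abs_self (a : ℝ)]
    exact_mod_cast this
  set S' : ℕ := ⌊(2 * y - a) / (P * R₀)⌋₊ with hS'
  have hS'1 : (2 * y - a) / (P * R₀) < (S' : ℝ) + 1 := Nat.lt_floor_add_one _
  have hstrip : ∀ n ∈ Ioc ⌊y⌋₊ ⌊2 * y⌋₊, (((n : ℤ) - a : ℤ) : ℝ) ≤ P * r * ((S' : ℝ) + 1) := by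
    intro n hn
    have hb := mem_Ioc_floor_bounds (zero_le_one.trans hy) hn
    push_cast
    have h1 : (n : ℝ) - a ≤ 2 * y - a := by linarith
    have h2 : 2 * y - a = (2 * y - a) / (P * R₀) * (P * R₀) := by field_simp
    have h3 : (2 * y - a) / (P * R₀) * (P * R₀) ≤ ((S' : ℝ) + 1) * (P * R₀) := by
      refine mul_le_mul_of_nonneg_right hS'1.le (by positivity)
    have h4 : ((S' : ℝ) + 1) * (P * R₀) ≤ ((S' : ℝ) + 1) * (P * r) := by
      refine mul_le_mul_of_nonneg_left ?_ (by positivity)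
      exact mul_le_mul_of_nonneg_left hr.le hP.le
    linarith
  have h := switch_sum_eq' a hr0 hP (Ioc ⌊y⌋₊ ⌊2 * y⌋₊) (fun n : ℕ => y < (n : ℝ) ∧ (n : ℝ) ≤ 2 * y)
    (fun n => (Λ n : ℝ)) hpos hstrip (P' := P')
  simp only [ivlCongr_eq_sum_dvd]
  rw [h]
  rfl

/-! ### The cells and the nominal intervals -/

/-- The lower end of the nominal `n`-interval of the cell `(R₀, λR₀] × (S, λS]`:
`max(y, a + P λ² R₀ S)`. [cite: BombieriFriedlanderIwaniecActa1986, §13 p. 242] -/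
noncomputable def cLo (a : ℤ) (y P R₀ lam S : ℝ) : ℝ := max y (a + P * lam ^ 2 * R₀ * S)

/-- The upper end of the nominal `n`-interval of the cell: `min(2y, a + P' R₀ S)`.
[cite: BombieriFriedlanderIwaniecActa1986, §13 p. 242] -/
noncomputable def cHi (a : ℤ) (y P' R₀ S : ℝ) : ℝ := min (2 * y) (a + P' * R₀ * S)

/-- `y ≤ cLo`. [folklore] -/
theorem le_cLo (a : ℤ) (y P R₀ lam S : ℝ) : y ≤ cLo a y P R₀ lam S := le_max_left _ _

/-- `cHi ≤ 2y`. [folklore] -/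
theorem cHi_le (a : ℤ) (y P' R₀ S : ℝ) : cHi a y P' R₀ S ≤ 2 * y := min_le_left _ _

/-- The layer sum at `(r, s)` in the cell with lower corner `(R₀, S)`: the part of `swTrue(r, s)` NOT in
the nominal interval. [folklore] -/
noncomputable def layer (a : ℤ) (y P P' R₀ lam S : ℝ) (r s : ℕ) : ℝ :=
  swTrue a y P P' r s - ivlCongr (s * r) a (cLo a y P R₀ lam S) (cHi a y P' R₀ S) y

/-- **On a cell the nominal interval lies inside every true range**: for `R₀ < r ≤ λR₀`,
`S < s ≤ λS` (`λ ≥ 1`, `P, P', R₀, S ≥ 0`), the condition `cLo < n ≤ cHi` implies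
`P rs < n − a ≤ P' rs`; hence `swTrue(r,s) = ivlCongr(sr; cLo, cHi) + layer(r,s)` with
`0 ≤ layer(r,s) = ∑_{n in the true range but not the nominal one} Λ(n) 1_{sr ∣ n − a}`.
[cite: BombieriFriedlanderIwaniecActa1986, §13 p. 242] -/
theorem layer_eq_sum (a : ℤ) {y P P' R₀ lam S : ℝ} (hP : 0 ≤ P) (hP' : 0 ≤ P') (hR₀ : 0 ≤ R₀)
    (hS : 0 ≤ S) {r s : ℕ} (hr1 : R₀ < r) (hr2 : (r : ℝ) ≤ lam * R₀)
    (hs1 : S < s) (hs2 : (s : ℝ) ≤ lam * S) :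
    layer a y P P' R₀ lam S r s = ∑ n ∈ Ioc ⌊y⌋₊ ⌊2 * y⌋₊,
      (if ((y < (n : ℝ) ∧ (n : ℝ) ≤ 2 * y) ∧ ((s * r : ℕ) : ℤ) ∣ (n : ℤ) - a ∧
            P * r * s < ((n : ℤ) - a : ℤ) ∧ (((n : ℤ) - a : ℤ) : ℝ) ≤ P' * r * s) ∧
          ¬ (cLo a y P R₀ lam S < (n : ℝ) ∧ (n : ℝ) ≤ cHi a y P' R₀ S)
        then (Λ n : ℝ) else 0) := by
  unfold layer swTrue
  rw [ivlCongr_eq_sum_dvd, ← Finset.sum_sub_distrib]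
  refine Finset.sum_congr rfl fun n _ => ?_
  -- nominal ⇒ true
  have himp : (cLo a y P R₀ lam S < (n : ℝ) ∧ (n : ℝ) ≤ cHi a y P' R₀ S) ∧
      ((s * r : ℕ) : ℤ) ∣ (n : ℤ) - a →
      (y < (n : ℝ) ∧ (n : ℝ) ≤ 2 * y) ∧ ((s * r : ℕ) : ℤ) ∣ (n : ℤ) - a ∧
        P * r * s < ((n : ℤ) - a : ℤ) ∧ (((n : ℤ) - a : ℤ) : ℝ) ≤ P' * r * s := by
    rintro ⟨⟨h1, h2⟩, hd⟩
    have hlo := max_lt_iff.1 h1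
    have hhi := le_min_iff.1 h2
    have hr0 : (0 : ℝ) ≤ r := Nat.cast_nonneg _
    have hs0 : (0 : ℝ) ≤ s := Nat.cast_nonneg _
    have hlam1 : (r : ℝ) * s ≤ lam ^ 2 * R₀ * S := by
      calc (r : ℝ) * s ≤ (lam * R₀) * (lam * S) := mul_le_mul hr2 hs2 hs0 (by nlinarith)
        _ = lam ^ 2 * R₀ * S := by ring
    have hlow : R₀ * S ≤ (r : ℝ) * s := mul_le_mul hr1.le hs1.le hS hr0
    refine ⟨⟨hlo.1, hhi.1⟩, hd, ?_, ?_⟩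
    · push_cast
      have : P * (r * s) ≤ P * (lam ^ 2 * R₀ * S) := mul_le_mul_of_nonneg_left hlam1 hP
      nlinarith [hlo.2]
    · push_cast
      have : P' * (R₀ * S) ≤ P' * (r * s) := mul_le_mul_of_nonneg_left hlow hP'
      nlinarith [hhi.2]
  by_cases hT : (y < (n : ℝ) ∧ (n : ℝ) ≤ 2 * y) ∧ ((s * r : ℕ) : ℤ) ∣ (n : ℤ) - a ∧
      P * r * s < ((n : ℤ) - a : ℤ) ∧ (((n : ℤ) - a : ℤ) : ℝ) ≤ P' * r * s
  · have hd : ((s * r : ℕ) : ℤ) ∣ (n : ℤ) - a := hT.2.1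
    by_cases hN : cLo a y P R₀ lam S < (n : ℝ) ∧ (n : ℝ) ≤ cHi a y P' R₀ S
    · have h2 : (cLo a y P R₀ lam S < (n : ℝ) ∧ (n : ℝ) ≤ cHi a y P' R₀ S) ∧
          ((s * r : ℕ) : ℤ) ∣ (n : ℤ) - a := And.intro hN hd
      have h3 : ¬ (((y < (n : ℝ) ∧ (n : ℝ) ≤ 2 * y) ∧ ((s * r : ℕ) : ℤ) ∣ (n : ℤ) - a ∧
          P * r * s < ((n : ℤ) - a : ℤ) ∧ (((n : ℤ) - a : ℤ) : ℝ) ≤ P' * r * s) ∧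
          ¬ (cLo a y P R₀ lam S < (n : ℝ) ∧ (n : ℝ) ≤ cHi a y P' R₀ S)) := fun h => h.2 hN
      rw [if_pos hT, if_pos h2, if_neg h3]; ring
    · have h2 : ¬ ((cLo a y P R₀ lam S < (n : ℝ) ∧ (n : ℝ) ≤ cHi a y P' R₀ S) ∧
          ((s * r : ℕ) : ℤ) ∣ (n : ℤ) - a) := fun h => hN h.1
      have h3 : ((y < (n : ℝ) ∧ (n : ℝ) ≤ 2 * y) ∧ ((s * r : ℕ) : ℤ) ∣ (n : ℤ) - a ∧
          P * r * s < ((n : ℤ) - a : ℤ) ∧ (((n : ℤ) - a : ℤ) : ℝ) ≤ P' * r * s) ∧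
          ¬ (cLo a y P R₀ lam S < (n : ℝ) ∧ (n : ℝ) ≤ cHi a y P' R₀ S) := And.intro hT hN
      rw [if_pos hT, if_neg h2, if_pos h3]; ring
  · have h2 : ¬ ((cLo a y P R₀ lam S < (n : ℝ) ∧ (n : ℝ) ≤ cHi a y P' R₀ S) ∧
        ((s * r : ℕ) : ℤ) ∣ (n : ℤ) - a) := fun h => hT (himp h)
    have h3 : ¬ (((y < (n : ℝ) ∧ (n : ℝ) ≤ 2 * y) ∧ ((s * r : ℕ) : ℤ) ∣ (n : ℤ) - a ∧
        P * r * s < ((n : ℤ) - a : ℤ) ∧ (((n : ℤ) - a : ℤ) : ℝ) ≤ P' * r * s) ∧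
        ¬ (cLo a y P R₀ lam S < (n : ℝ) ∧ (n : ℝ) ≤ cHi a y P' R₀ S)) := fun h => hT h.1
    rw [if_neg hT, if_neg h2, if_neg h3]; ring

/-- `layer ≥ 0` on a cell. [folklore] -/
theorem layer_nonneg (a : ℤ) {y P P' R₀ lam S : ℝ} (hP : 0 ≤ P) (hP' : 0 ≤ P') (hR₀ : 0 ≤ R₀)
    (hS : 0 ≤ S) {r s : ℕ} (hr1 : R₀ < r) (hr2 : (r : ℝ) ≤ lam * R₀)
    (hs1 : S < s) (hs2 : (s : ℝ) ≤ lam * S) : 0 ≤ layer a y P P' R₀ lam S r s := by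
  rw [layer_eq_sum a hP hP' hR₀ hS hr1 hr2 hs1 hs2]
  exact Finset.sum_nonneg fun n _ => by
    split_ifs
    · exact ArithmeticFunction.vonMangoldt_nonneg
    · exact le_rfl

/-- **The layers are thin**: on a cell (`1 ≤ λ`, `λ² − 1 ≤ 3η`, `P' ≤ 2P`, `y ≥ 1`),
`layer(r, s) ≤ log(2y) · (9ηP + 4)`: the admissible `n` outside the nominal interval lie in the two
intervals `(a + P R₀S, a + Pλ²R₀S]`, `(a + P'R₀S, a + P'λ²R₀S]`, of lengths `≤ 3ηP rs`, `≤ 6ηP rs`,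
each containing at most `length/(rs) + 2` integers `≡ a (mod rs)` (floors included).
[cite: BombieriFriedlanderIwaniecActa1986, §13 p. 242] -/
theorem layer_le (a : ℤ) {y P P' R₀ lam η S : ℝ} (hy : 1 ≤ y) (hP : 0 ≤ P) (hPP' : P ≤ P')
    (hP'2 : P' ≤ 2 * P) (hR₀ : 0 ≤ R₀) (hS : 0 ≤ S) (hη : 0 ≤ η) (hlam : 1 ≤ lam)
    (hlamη : lam ^ 2 - 1 ≤ 3 * η) {r s : ℕ} (hr1 : R₀ < r) (hr2 : (r : ℝ) ≤ lam * R₀)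
    (hs1 : S < s) (hs2 : (s : ℝ) ≤ lam * S) :
    layer a y P P' R₀ lam S r s ≤ Real.log (2 * y) * (9 * η * P + 4) := by
  have hP' : 0 ≤ P' := hP.trans hPP'
  have hy0 : 0 ≤ y := zero_le_one.trans hy
  have hr0 : (0 : ℝ) < r := hR₀.trans_lt hr1
  have hs0 : (0 : ℝ) < s := hS.trans_lt hs1
  have hrs0 : 0 < s * r := by
    have : (0 : ℝ) < (s : ℝ) * r := mul_pos hs0 hr0
    exact_mod_cast this
  have hlog0 : 0 ≤ Real.log (2 * y) := Real.log_nonneg (by linarith)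
  rw [layer_eq_sum a hP hP' hR₀ hS hr1 hr2 hs1 hs2, ← Finset.sum_filter]
  -- the admissible `n` lie in the two layers
  set d : ℕ := s * r with hd
  set u₁ : ℝ := a + P * R₀ * S with hu₁
  set v₁ : ℝ := a + P * lam ^ 2 * R₀ * S with hv₁
  set u₂ : ℝ := a + P' * R₀ * S with hu₂
  set v₂ : ℝ := a + P' * lam ^ 2 * R₀ * S with hv₂
  have hRS : R₀ * S ≤ (r : ℝ) * s := mul_le_mul hr1.le hs1.le hS hr0.le
  have hrslam : (r : ℝ) * s ≤ lam ^ 2 * R₀ * S := by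
    calc (r : ℝ) * s ≤ (lam * R₀) * (lam * S) := mul_le_mul hr2 hs2 hs0.le (by nlinarith)
      _ = lam ^ 2 * R₀ * S := by ring
  -- the layers as sets of naturals: `A₁ = (⌊u₁⌋, ⌊v₁⌋]`, `A₂ = (⌊u₂⌋, ⌊v₂⌋]`, intersected with `d ∣ n - a`
  set T := (Ioc ⌊y⌋₊ ⌊2 * y⌋₊).filter (fun n : ℕ =>
      ((y < (n : ℝ) ∧ (n : ℝ) ≤ 2 * y) ∧ (d : ℤ) ∣ (n : ℤ) - a ∧
          P * r * s < ((n : ℤ) - a : ℤ) ∧ (((n : ℤ) - a : ℤ) : ℝ) ≤ P' * r * s) ∧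
        ¬ (cLo a y P R₀ lam S < (n : ℝ) ∧ (n : ℝ) ≤ cHi a y P' R₀ S)) with hT
  have hTsub : T ⊆ ((Ioc ⌊u₁⌋₊ ⌊v₁⌋₊).filter (fun n : ℕ => (d : ℤ) ∣ (n : ℤ) - a)) ∪
      ((Ioc ⌊u₂⌋₊ ⌊v₂⌋₊).filter (fun n : ℕ => (d : ℤ) ∣ (n : ℤ) - a)) := by
    intro n hn
    rw [hT, Finset.mem_filter] at hn
    obtain ⟨-, ⟨⟨hy1, hy2⟩, hdvd, hlt, hle⟩, hnot⟩ := hn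
    push_cast at hlt hle
    rw [Finset.mem_union, Finset.mem_filter, Finset.mem_filter, Finset.mem_Ioc, Finset.mem_Ioc]
    -- `n` is not in the nominal interval: either `n ≤ cLo` or `n > cHi`
    rw [not_and_or, not_lt, not_le] at hnot
    have hn0 : (0 : ℝ) ≤ n := Nat.cast_nonneg _
    rcases hnot with h1 | h2
    · -- `n ≤ max y (a + Pλ²R₀S)`; since `n > y`, `n ≤ v₁`; and `n > a + P r s ≥ u₁`
      left
      have hnv : (n : ℝ) ≤ v₁ := by
        rcases le_max_iff.1 h1 with h | h
        · linarith
        · exact h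
      have hnu : u₁ < n := by
        have : P * (R₀ * S) ≤ P * (r * s) := mul_le_mul_of_nonneg_left hRS hP
        rw [hu₁]; nlinarith
      have hu0 : 0 ≤ u₁ ∨ u₁ < 0 := le_or_gt 0 u₁
      refine ⟨⟨?_, Nat.le_floor hnv⟩, hdvd⟩
      rcases hu0 with hu0 | hu0
      · exact (Nat.floor_lt hu0).2 hnu
      · rw [Nat.floor_of_nonpos hu0.le]
        have : (0 : ℝ) < n := by linarith
        exact_mod_cast this
    · -- `n > min (2y) (a + P'R₀S)`; since `n ≤ 2y`, `n > u₂`; and `n ≤ a + P' r s ≤ v₂`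
      right
      have hnu : u₂ < n := by
        rcases min_lt_iff.1 h2 with h | h
        · linarith
        · exact h
      have hnv : (n : ℝ) ≤ v₂ := by
        have : P' * (r * s) ≤ P' * (lam ^ 2 * R₀ * S) := mul_le_mul_of_nonneg_left hrslam hP'
        rw [hv₂]; nlinarith
      have hu0 : 0 ≤ u₂ ∨ u₂ < 0 := le_or_gt 0 u₂
      refine ⟨⟨?_, Nat.le_floor hnv⟩, hdvd⟩
      rcases hu0 with hu0 | hu0
      · exact (Nat.floor_lt hu0).2 hnu
      · rw [Nat.floor_of_nonpos hu0.le]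
        have : (0 : ℝ) < n := by linarith
        exact_mod_cast this
  -- bound the sum by `log(2y) · #T`
  have hsum : ∑ n ∈ T, (Λ n : ℝ) ≤ Real.log (2 * y) * T.card := by
    calc ∑ n ∈ T, (Λ n : ℝ) ≤ ∑ n ∈ T, Real.log (2 * y) := by
          refine Finset.sum_le_sum fun n hn => ?_
          have hb := mem_Ioc_floor_bounds hy0 (Finset.mem_filter.1 hn).1
          have hn0 : (0 : ℝ) < n := by linarith
          exact ArithmeticFunction.vonMangoldt_le_log.trans (Real.log_le_log hn0 hb.2)
      _ = Real.log (2 * y) * T.card := by rw [Finset.sum_const, nsmul_eq_mul, mul_comm]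
  refine hsum.trans (mul_le_mul_of_nonneg_left ?_ hlog0)
  -- count: `#T ≤ #A₁ + #A₂ ≤ (v₁ - u₁)/d + 1 + (v₂ - u₂)/d + 1`
  have hdr : (0 : ℝ) < d := by rw [hd]; exact_mod_cast hrs0
  have hd' : (d : ℝ) = (r : ℝ) * s := by rw [hd]; push_cast; ring
  have hcount : ∀ u v : ℝ, u ≤ v →
      ((((Ioc ⌊u⌋₊ ⌊v⌋₊).filter (fun n : ℕ => (d : ℤ) ∣ (n : ℤ) - a)).card : ℝ)) ≤ (v - u) / d + 2 := by
    intro u v huv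
    rcases le_or_gt 0 u with hu0 | hu0
    · have h := card_Ioc_filter_intCast_dvd_sub_le hrs0 a (Nat.floor_le_floor huv)
      refine h.trans ?_
      have h1 : ((⌊v⌋₊ : ℝ) - ⌊u⌋₊) ≤ v - u + 1 := by
        have := Nat.floor_le (hu0.trans huv)
        have := Nat.lt_floor_add_one u
        linarith
      have h2 : ((⌊v⌋₊ : ℝ) - ⌊u⌋₊) / d ≤ (v - u) / d + 1 / d := by
        rw [← add_div]; exact div_le_div_of_nonneg_right h1 hdr.le
      have h3 : 1 / (d : ℝ) ≤ 1 := by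
        rw [div_le_one hdr]; exact_mod_cast hrs0
      linarith
    · -- `u < 0`: then `⌊u⌋ = 0`; compare with the interval `(0, v]`
      rw [Nat.floor_of_nonpos hu0.le]
      rcases le_or_gt 0 v with hv0 | hv0
      · have h := card_Ioc_filter_intCast_dvd_sub_le hrs0 a (Nat.zero_le ⌊v⌋₊)
        push_cast at h
        rw [sub_zero] at h
        refine h.trans ?_
        have h1 : (⌊v⌋₊ : ℝ) ≤ v - u := by have := Nat.floor_le hv0; linarith
        have := div_le_div_of_nonneg_right h1 hdr.le
        linarith
      · rw [Nat.floor_of_nonpos hv0.le]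
        simp only [Finset.Ioc_self, Finset.filter_empty, Finset.card_empty, Nat.cast_zero]
        have : 0 ≤ (v - u) / d := div_nonneg (by linarith) hdr.le
        linarith
  have hlamge : lam ^ 2 - 1 ≥ 0 := by nlinarith
  have e₁ : v₁ - u₁ = P * (lam ^ 2 - 1) * (R₀ * S) := by rw [hv₁, hu₁]; ring
  have e₂ : v₂ - u₂ = P' * (lam ^ 2 - 1) * (R₀ * S) := by rw [hv₂, hu₂]; ring
  have hlen₁ : v₁ - u₁ ≤ 3 * η * P * ((r : ℝ) * s) := by
    rw [e₁]
    calc P * (lam ^ 2 - 1) * (R₀ * S) ≤ P * (3 * η) * (r * s) := by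
          refine mul_le_mul (mul_le_mul_of_nonneg_left hlamη hP) hRS (by positivity) (by positivity)
      _ = 3 * η * P * (r * s) := by ring
  have hlen₂ : v₂ - u₂ ≤ 6 * η * P * ((r : ℝ) * s) := by
    rw [e₂]
    calc P' * (lam ^ 2 - 1) * (R₀ * S) ≤ (2 * P) * (3 * η) * (r * s) := by
          refine mul_le_mul (mul_le_mul hP'2 hlamη hlamge (by positivity)) hRS (by positivity)
            (by positivity)
      _ = 6 * η * P * (r * s) := by ring
  have huv₁ : u₁ ≤ v₁ := by
    have : 0 ≤ P * (lam ^ 2 - 1) * (R₀ * S) := mul_nonneg (mul_nonneg hP hlamge) (mul_nonneg hR₀ hS)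
    linarith
  have huv₂ : u₂ ≤ v₂ := by
    have : 0 ≤ P' * (lam ^ 2 - 1) * (R₀ * S) := mul_nonneg (mul_nonneg hP' hlamge) (mul_nonneg hR₀ hS)
    linarith
  calc (T.card : ℝ) ≤ ((((Ioc ⌊u₁⌋₊ ⌊v₁⌋₊).filter (fun n : ℕ => (d : ℤ) ∣ (n : ℤ) - a)) ∪
        ((Ioc ⌊u₂⌋₊ ⌊v₂⌋₊).filter (fun n : ℕ => (d : ℤ) ∣ (n : ℤ) - a))).card : ℝ) := by
        exact_mod_cast Finset.card_le_card hTsub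
    _ ≤ (((Ioc ⌊u₁⌋₊ ⌊v₁⌋₊).filter (fun n : ℕ => (d : ℤ) ∣ (n : ℤ) - a)).card : ℝ) +
        (((Ioc ⌊u₂⌋₊ ⌊v₂⌋₊).filter (fun n : ℕ => (d : ℤ) ∣ (n : ℤ) - a)).card : ℝ) := by
        exact_mod_cast Finset.card_union_le _ _
    _ ≤ ((v₁ - u₁) / d + 2) + ((v₂ - u₂) / d + 2) := add_le_add (hcount u₁ v₁ huv₁) (hcount u₂ v₂ huv₂)
    _ ≤ (3 * η * P + 2) + (6 * η * P + 2) := by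
        have h1 : (v₁ - u₁) / d ≤ 3 * η * P := by
          rw [div_le_iff₀ hdr, hd']; exact hlen₁
        have h2 : (v₂ - u₂) / d ≤ 6 * η * P := by
          rw [div_le_iff₀ hdr, hd']; exact hlen₂
        linarith
    _ = 9 * η * P + 4 := by ring

/-! ### Moduli not coprime to `a`: only prime powers `p^k`, `p ∣ a`, are counted -/

/-- If `(q, a) > 1` and `qr ∣ n − a` then `n` is not coprime to `|a|` (a common prime of `q` and `a`
divides `n`). [folklore] -/
theorem not_coprime_natAbs_of_dvd {q r n : ℕ} {a : ℤ} (hq : ¬ IsCoprime (q : ℤ) a)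
    (hd : ((q * r : ℕ) : ℤ) ∣ (n : ℤ) - a) : ¬ n.Coprime a.natAbs := by
  intro hn
  apply hq
  rw [Int.isCoprime_iff_gcd_eq_one]
  -- any common prime of `q` and `a` divides `n`, hence `gcd(n, |a|)`
  by_contra hg
  obtain ⟨p, hp, hpg⟩ := Nat.exists_prime_and_dvd hg
  have hpq : p ∣ q := by
    have : (Int.gcd (q : ℤ) a) ∣ q := by
      have := Int.gcd_dvd_left (q : ℤ) a
      exact_mod_cast this
    exact hpg.trans this
  have hpa : p ∣ a.natAbs := by
    have h1 : ((Int.gcd (q : ℤ) a : ℕ) : ℤ) ∣ a := Int.gcd_dvd_right (q : ℤ) a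
    have h2 : (Int.gcd (q : ℤ) a) ∣ a.natAbs := by
      rwa [Int.natCast_dvd] at h1
    exact hpg.trans h2
  have hpn : p ∣ n := by
    have h1 : (p : ℤ) ∣ (n : ℤ) - a :=
      ((Int.natCast_dvd_natCast.2 (hpq.trans (Nat.dvd_mul_right q r))).trans hd)
    have h2 : (p : ℤ) ∣ a := by rw [← Int.dvd_natAbs]; exact_mod_cast hpa
    have h3 : (p : ℤ) ∣ (n : ℤ) := by have := dvd_add h1 h2; rwa [sub_add_cancel] at this
    exact_mod_cast h3
  have : p ∣ Nat.gcd n a.natAbs := Nat.dvd_gcd hpn hpa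
  rw [hn] at this
  exact hp.ne_one (Nat.dvd_one.1 this)

/-- **Congruence sums to moduli not coprime to `a` are negligible**: for sets `Sq ⊆ [1, Qn]`,
`Sr ⊆ [1, Rn]` of the two factors, any interval conditions `c₁(q) < n ≤ c₂(q)`, `y ≥ |a|`, and
`τ(n − a) ≤ D` on `(y, 2y]`,
`∑_{r ∈ Sr} ∑_{q ∈ Sq, (q,a)>1} ivlCongr(qr; c₁(q), c₂(q)) ≤ D² · ∑_{n ≤ 2y, (n,|a|)>1} Λ(n)`:
each such congruence forces a prime of `a` to divide `n`, and for each `n` the pairs `qr ∣ n − a` are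
at most `τ(n − a)²`. [cite: BombieriFriedlanderIwaniecActa1986, §16 p. 250 (the coprimality conditions of Theorem 9)] -/
theorem sum_sum_notCoprime_ivlCongr_le {a : ℤ} {y D : ℝ} (hy : 1 ≤ y) (hay : |(a : ℝ)| ≤ y)
    {Qn Rn : ℕ} {Sq Sr : Finset ℕ} (hSq : Sq ⊆ Icc 1 Qn) (hSr : Sr ⊆ Icc 1 Rn) (c₁ c₂ : ℕ → ℝ)
    (hD : ∀ n ∈ Ioc ⌊y⌋₊ ⌊2 * y⌋₊, (σ 0 ((n : ℤ) - a).natAbs : ℝ) ≤ D) :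
    ∑ r ∈ Sr, ∑ q ∈ Sq.filter (fun q : ℕ => ¬ IsCoprime (q : ℤ) a), ivlCongr (q * r) a (c₁ q) (c₂ q) y ≤
      D ^ 2 * Literature.NumberTheory.Sieve.nonCoprimePart a.natAbs (2 * y) := by
  have hy0 : 0 ≤ y := zero_le_one.trans hy
  set W := (Ioc ⌊y⌋₊ ⌊2 * y⌋₊).filter (fun n : ℕ => ¬ n.Coprime a.natAbs) with hW
  -- step 1: pointwise, drop the interval condition and insert `¬ n.Coprime |a|`
  have h1 : ∀ r ∈ Sr, ∀ q ∈ Sq.filter (fun q : ℕ => ¬ IsCoprime (q : ℤ) a),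
      ivlCongr (q * r) a (c₁ q) (c₂ q) y ≤
        ∑ n ∈ W, (Λ n : ℝ) * (if ((q * r : ℕ) : ℤ) ∣ (n : ℤ) - a then (1 : ℝ) else 0) := by
    intro r _ q hq
    have hqa : ¬ IsCoprime (q : ℤ) a := (Finset.mem_filter.1 hq).2
    rw [ivlCongr_eq_sum_dvd, hW, Finset.sum_filter]
    refine Finset.sum_le_sum fun n _ => ?_
    by_cases hdvd : ((q * r : ℕ) : ℤ) ∣ (n : ℤ) - a
    · have hnc : ¬ n.Coprime a.natAbs := not_coprime_natAbs_of_dvd hqa hdvd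
      rw [if_pos hnc, if_pos hdvd, mul_one]
      split_ifs
      · exact le_rfl
      · exact ArithmeticFunction.vonMangoldt_nonneg
    · rw [if_neg (fun h => hdvd h.2), if_neg hdvd, mul_zero]
      split_ifs <;> exact le_rfl
  -- step 2: sum and interchange
  calc ∑ r ∈ Sr, ∑ q ∈ Sq.filter (fun q : ℕ => ¬ IsCoprime (q : ℤ) a), ivlCongr (q * r) a (c₁ q) (c₂ q) y
      ≤ ∑ r ∈ Sr, ∑ q ∈ Sq.filter (fun q : ℕ => ¬ IsCoprime (q : ℤ) a),
          ∑ n ∈ W, (Λ n : ℝ) * (if ((q * r : ℕ) : ℤ) ∣ (n : ℤ) - a then (1 : ℝ) else 0) :=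
        Finset.sum_le_sum fun r hr => Finset.sum_le_sum fun q hq => h1 r hr q hq
    _ ≤ ∑ r ∈ Icc 1 Rn, ∑ q ∈ Icc 1 Qn,
          ∑ n ∈ W, (Λ n : ℝ) * (if ((q * r : ℕ) : ℤ) ∣ (n : ℤ) - a then (1 : ℝ) else 0) := by
        have hnn : ∀ r q, 0 ≤ ∑ n ∈ W, (Λ n : ℝ) * (if ((q * r : ℕ) : ℤ) ∣ (n : ℤ) - a then (1 : ℝ) else 0) :=
          fun r q => Finset.sum_nonneg fun n _ => mul_nonneg ArithmeticFunction.vonMangoldt_nonneg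
            (by split_ifs <;> norm_num)
        refine (Finset.sum_le_sum fun r _ => Finset.sum_le_sum_of_subset_of_nonneg
          ((Finset.filter_subset _ _).trans hSq) fun q _ _ => hnn r q).trans ?_
        exact Finset.sum_le_sum_of_subset_of_nonneg hSr fun r _ _ => Finset.sum_nonneg fun q _ => hnn r q
    _ = ∑ n ∈ W, (Λ n : ℝ) * ∑ q ∈ Icc 1 Qn, ∑ r ∈ Icc 1 Rn,
          (if ((q * r : ℕ) : ℤ) ∣ (n : ℤ) - a then (1 : ℝ) else 0) := by
        have e1 : ∀ r : ℕ, ∑ q ∈ Icc 1 Qn, ∑ n ∈ W,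
            (Λ n : ℝ) * (if ((q * r : ℕ) : ℤ) ∣ (n : ℤ) - a then (1 : ℝ) else 0) =
            ∑ n ∈ W, ∑ q ∈ Icc 1 Qn,
              (Λ n : ℝ) * (if ((q * r : ℕ) : ℤ) ∣ (n : ℤ) - a then (1 : ℝ) else 0) :=
          fun r => Finset.sum_comm
        simp_rw [e1]
        rw [Finset.sum_comm]
        refine Finset.sum_congr rfl fun n _ => ?_
        rw [Finset.mul_sum]
        simp_rw [Finset.mul_sum]
        exact Finset.sum_comm
    _ ≤ ∑ n ∈ W, (Λ n : ℝ) * D ^ 2 := by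
        refine Finset.sum_le_sum fun n hn => ?_
        have hnI := (Finset.mem_filter.1 hn).1
        refine mul_le_mul_of_nonneg_left ?_ ArithmeticFunction.vonMangoldt_nonneg
        have hb := mem_Ioc_floor_bounds hy0 hnI
        have hna : (n : ℤ) - a ≠ 0 := by
          have : (a : ℝ) < n := by linarith [le_abs_self (a : ℝ)]
          have : a < (n : ℤ) := by exact_mod_cast this
          omega
        have h := sum_sum_dvd_indicator_le Qn Rn ((n : ℤ) - a)
        rw [if_neg hna] at h
        refine h.trans ?_
        have hD' := hD n hnI
        have h0 : (0 : ℝ) ≤ σ 0 ((n : ℤ) - a).natAbs := Nat.cast_nonneg _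
        exact pow_le_pow_left₀ h0 hD' 2
    _ = D ^ 2 * ∑ n ∈ W, (Λ n : ℝ) := by rw [Finset.mul_sum]; exact Finset.sum_congr rfl fun n _ => by ring
    _ ≤ D ^ 2 * Literature.NumberTheory.Sieve.nonCoprimePart a.natAbs (2 * y) := by
        refine mul_le_mul_of_nonneg_left ?_ (sq_nonneg _)
        rw [hW, Literature.NumberTheory.Sieve.nonCoprimePart]
        refine Finset.sum_le_sum_of_subset_of_nonneg ?_ fun _ _ _ => ArithmeticFunction.vonMangoldt_nonneg
        intro n hn
        rw [Finset.mem_filter, Finset.mem_Ioc] at hn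
        rw [Finset.mem_filter, Finset.mem_range]
        exact ⟨by omega, hn.2⟩

/-! ### The block sum for one `r`: definitions -/

/-- The top of the `s`-range: `s_hi = (2y − a)/(P R₀)`. [folklore] -/
noncomputable def sHi (a : ℤ) (y P R₀ : ℝ) : ℝ := (2 * y - a) / (P * R₀)

/-- The lower corner `S_j = s_hi λ^{−(j+1)}` of the `j`-th `s`-cell `(S_j, λ S_j]`. [folklore] -/
noncomputable def sLow (shi lam : ℝ) (j : ℕ) : ℝ := shi / lam ^ (j + 1)

/-- The `j`-th `s`-cell `(⌊s_hi λ^{−(j+1)}⌋, ⌊s_hi λ^{−j}⌋]`. [folklore] -/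
noncomputable def sCell (shi lam : ℝ) (j : ℕ) : Finset ℕ := Ioc ⌊shi / lam ^ (j + 1)⌋₊ ⌊shi / lam ^ j⌋₊

/-- The original subtracted mean values of the block: `M(r) = ∑_{P<q≤P',(q,a)=1} φ(qr)⁻¹ ∑_{(n,qr)=1} Λ(n)`.
[cite: BombieriFriedlanderIwaniecActa1986, §16 p. 250] -/
noncomputable def mOrig (a : ℤ) (y P P' : ℝ) (r : ℕ) : ℝ :=
  ∑ q ∈ (Ioc ⌊P⌋₊ ⌊P'⌋₊).filter (fun q : ℕ => IsCoprime (q : ℤ) a),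
    ivlCop (q * r) y (2 * y) y / (Nat.totient (q * r) : ℝ)

/-- The switched mean values: `M^{sw}(r) = ∑_j ∑_{s ∈ cell_j, (s,a)=1} φ(sr)⁻¹ ∑_{n ∈ nominal_j, (n,sr)=1} Λ(n)`.
[cite: BombieriFriedlanderIwaniecActa1986, §13 p. 242] -/
noncomputable def mSw (a : ℤ) (y P P' R₀ lam : ℝ) (J : ℕ) (r : ℕ) : ℝ :=
  ∑ j ∈ Finset.range J, ∑ s ∈ (sCell (sHi a y P R₀) lam j).filter (fun s : ℕ => IsCoprime (s : ℤ) a),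
    ivlCop (s * r) (cLo a y P R₀ lam (sLow (sHi a y P R₀) lam j))
      (cHi a y P' R₀ (sLow (sHi a y P R₀) lam j)) y / (Nat.totient (s * r) : ℝ)

/-- The discrepancy part: `A(r) = ∑_j ∑_{s ∈ cell_j, (s,a)=1} discIvl(sr; nominal_j)`. [folklore] -/
noncomputable def aPart (a : ℤ) (y P P' R₀ lam : ℝ) (J : ℕ) (r : ℕ) : ℝ :=
  ∑ j ∈ Finset.range J, ∑ s ∈ (sCell (sHi a y P R₀) lam j).filter (fun s : ℕ => IsCoprime (s : ℤ) a),
    discIvl (s * r) a (cLo a y P R₀ lam (sLow (sHi a y P R₀) lam j))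
      (cHi a y P' R₀ (sLow (sHi a y P R₀) lam j)) y

/-- The `q` not coprime to `a`: `E₁(r) = ∑_{P<q≤P',(q,a)>1} ivlCongr(qr; y, 2y)`. [folklore] -/
noncomputable def eOne (a : ℤ) (y P P' : ℝ) (r : ℕ) : ℝ :=
  ∑ q ∈ (Ioc ⌊P⌋₊ ⌊P'⌋₊).filter (fun q : ℕ => ¬ IsCoprime (q : ℤ) a), ivlCongr (q * r) a y (2 * y) y

/-- The `s` not coprime to `a`: `E₂(r) = ∑_j ∑_{s ∈ cell_j,(s,a)>1} ivlCongr(sr; nominal_j)`. [folklore] -/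
noncomputable def eTwo (a : ℤ) (y P P' R₀ lam : ℝ) (J : ℕ) (r : ℕ) : ℝ :=
  ∑ j ∈ Finset.range J, ∑ s ∈ (sCell (sHi a y P R₀) lam j).filter (fun s : ℕ => ¬ IsCoprime (s : ℤ) a),
    ivlCongr (s * r) a (cLo a y P R₀ lam (sLow (sHi a y P R₀) lam j))
      (cHi a y P' R₀ (sLow (sHi a y P R₀) lam j)) y

/-- The layers: `Lay(r) = ∑_j ∑_{s ∈ cell_j} layer_j(r, s)`. [folklore] -/
noncomputable def layAll (a : ℤ) (y P P' R₀ lam : ℝ) (J : ℕ) (r : ℕ) : ℝ :=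
  ∑ j ∈ Finset.range J, ∑ s ∈ sCell (sHi a y P R₀) lam j,
    layer a y P P' R₀ lam (sLow (sHi a y P R₀) lam j) r s

/-- **The decomposition of the block sum at `r`** (`y ≥ 1`, `|a| ≤ y`, `R₀ < r`, `0 < P`, `1 ≤ λ`,
`s_hi/λ^J < 1`):
`∑_{P<q≤P',(q,a)=1} E(y; qr, a) = A(r) + (M^{sw}(r) − M(r)) + (E₂(r) + Lay(r) − E₁(r))`.
[cite: BombieriFriedlanderIwaniecActa1986, §13 p. 241–242] -/
theorem blockSum_eq (a : ℤ) {y : ℝ} (hy : 1 ≤ y) (hay : |(a : ℝ)| ≤ y) {r : ℕ} {R₀ : ℝ}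
    (hR₀ : 0 < R₀) (hr : R₀ < r) {P P' lam : ℝ} (hP : 0 < P) (hlam : 1 ≤ lam) {J : ℕ}
    (hJ : sHi a y P R₀ / lam ^ J < 1) :
    ∑ q ∈ (Ioc ⌊P⌋₊ ⌊P'⌋₊).filter (fun q : ℕ => IsCoprime (q : ℤ) a), dyadDisc (q * r) a y =
      aPart a y P P' R₀ lam J r + (mSw a y P P' R₀ lam J r - mOrig a y P P' r) +
        (eTwo a y P P' R₀ lam J r + layAll a y P P' R₀ lam J r - eOne a y P P' r) := by
  have hy0 : 0 ≤ y := zero_le_one.trans hy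
  set Bq := (Ioc ⌊P⌋₊ ⌊P'⌋₊).filter (fun q : ℕ => IsCoprime (q : ℤ) a) with hBq
  set shi := sHi a y P R₀ with hshi
  -- (1) `dyadDisc = ivlCongr - ivlCop/φ`
  have h1 : ∑ q ∈ Bq, dyadDisc (q * r) a y =
      (∑ q ∈ Bq, ivlCongr (q * r) a y (2 * y) y) - mOrig a y P P' r := by
    rw [mOrig, ← hBq, ← Finset.sum_sub_distrib]
    refine Finset.sum_congr rfl fun q _ => ?_
    rw [dyadDisc_eq_discIvl _ _ hy0, discIvl]
  -- (2) remove the coprimality of `q`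
  have h2 : ∑ q ∈ Bq, ivlCongr (q * r) a y (2 * y) y =
      (∑ q ∈ Ioc ⌊P⌋₊ ⌊P'⌋₊, ivlCongr (q * r) a y (2 * y) y) - eOne a y P P' r := by
    rw [eOne, hBq, ← Finset.sum_filter_add_sum_filter_not (Ioc ⌊P⌋₊ ⌊P'⌋₊)
      (fun q : ℕ => IsCoprime (q : ℤ) a) (fun q => ivlCongr (q * r) a y (2 * y) y)]
    ring
  -- (3) the switch and the cells
  have hshi0 : 0 ≤ shi := by
    rw [hshi, sHi]
    refine div_nonneg ?_ (by positivity)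
    linarith [le_abs_self (a : ℝ)]
  have h3 : ∑ q ∈ Ioc ⌊P⌋₊ ⌊P'⌋₊, ivlCongr (q * r) a y (2 * y) y =
      ∑ j ∈ Finset.range J, ∑ s ∈ sCell shi lam j, swTrue a y P P' r s := by
    rw [sum_Ioc_ivlCongr_eq_sum_swTrue a hy hay hR₀ hr hP (P' := P')]
    rw [show (2 * y - a) / (P * R₀) = shi from rfl]
    rw [sum_Icc_floor_eq_sum_geomBlocks (fun s => swTrue a y P P' r s) hshi0 hlam hJ]
    rfl
  -- (4) each cell: `swTrue = ivlCongr(nominal) + layer`, split coprimality, `ivlCongr = discIvl + ivlCop/φ`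
  have h4 : ∀ j : ℕ, ∑ s ∈ sCell shi lam j, swTrue a y P P' r s =
      (∑ s ∈ (sCell shi lam j).filter (fun s : ℕ => IsCoprime (s : ℤ) a),
          discIvl (s * r) a (cLo a y P R₀ lam (sLow shi lam j)) (cHi a y P' R₀ (sLow shi lam j)) y) +
      (∑ s ∈ (sCell shi lam j).filter (fun s : ℕ => IsCoprime (s : ℤ) a),
          ivlCop (s * r) (cLo a y P R₀ lam (sLow shi lam j)) (cHi a y P' R₀ (sLow shi lam j)) y /
            (Nat.totient (s * r) : ℝ)) +
      (∑ s ∈ (sCell shi lam j).filter (fun s : ℕ => ¬ IsCoprime (s : ℤ) a),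
          ivlCongr (s * r) a (cLo a y P R₀ lam (sLow shi lam j)) (cHi a y P' R₀ (sLow shi lam j)) y) +
      ∑ s ∈ sCell shi lam j, layer a y P P' R₀ lam (sLow shi lam j) r s := by
    intro j
    have hl : ∀ s : ℕ, swTrue a y P P' r s =
        ivlCongr (s * r) a (cLo a y P R₀ lam (sLow shi lam j)) (cHi a y P' R₀ (sLow shi lam j)) y +
          layer a y P P' R₀ lam (sLow shi lam j) r s := fun s => by rw [layer]; ring
    rw [Finset.sum_congr rfl fun s _ => hl s, Finset.sum_add_distrib]
    congr 1
    rw [← Finset.sum_filter_add_sum_filter_not (sCell shi lam j) (fun s : ℕ => IsCoprime (s : ℤ) a)]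
    congr 1
    rw [← Finset.sum_add_distrib]
    refine Finset.sum_congr rfl fun s _ => ?_
    rw [discIvl]; ring
  rw [h1, h2, h3, Finset.sum_congr rfl fun j _ => h4 j]
  rw [Finset.sum_add_distrib, Finset.sum_add_distrib, Finset.sum_add_distrib]
  rw [aPart, mSw, eTwo, layAll]
  ring

/-! ### Bounds for the error terms of the decomposition -/

/-- Membership in a cell gives the cell inequalities `S_j < s ≤ λ S_j`. [folklore] -/
theorem mem_sCell_bounds {shi lam : ℝ} (hshi : 0 ≤ shi) (hlam : 0 < lam) {j s : ℕ}
    (hs : s ∈ sCell shi lam j) : sLow shi lam j < s ∧ (s : ℝ) ≤ lam * sLow shi lam j := by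
  rw [sCell, Finset.mem_Ioc] at hs
  refine ⟨Nat.lt_of_floor_lt hs.1, ?_⟩
  have h1 : (s : ℝ) ≤ shi / lam ^ j := (Nat.cast_le.2 hs.2).trans (Nat.floor_le (by positivity))
  have e : lam * sLow shi lam j = shi / lam ^ j := by
    rw [sLow, pow_succ]; field_simp
  rw [e]; exact h1

/-- The cells partition `[1, ⌊s_hi⌋]`: `∑_{j<J} #cell_j = ⌊s_hi⌋` when `s_hi/λ^J < 1`. [folklore] -/
theorem sum_card_sCell_eq {shi lam : ℝ} (hshi : 0 ≤ shi) (hlam : 1 ≤ lam) {J : ℕ} (hJ : shi / lam ^ J < 1) :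
    ∑ j ∈ Finset.range J, ((sCell shi lam j).card : ℝ) = ⌊shi⌋₊ := by
  have h := sum_Icc_floor_eq_sum_geomBlocks (fun _ => (1 : ℝ)) hshi hlam hJ
  simp only [Finset.sum_const, nsmul_eq_mul, mul_one, Nat.card_Icc, Nat.add_sub_cancel] at h
  rw [h]
  rfl

/-- **The layers of one `r` are admissible**: for `r ∈ (R₀, λR₀]` (`0 < R₀`), `0 < P ≤ P' ≤ 2P`,
`1 ≤ λ`, `λ² − 1 ≤ 3η`, `η ≥ 0`, `y ≥ 1`, `|a| ≤ y`, `s_hi/λ^J < 1`: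
`Lay(r) ≤ 3λ y log(2y) (9η + 4/P)/r` (at most `log(2y)(9ηP + 4)` per `s ≤ s_hi`, and
`s_hi ≤ 3y/(PR₀) ≤ 3λy/(P r)`). [cite: BombieriFriedlanderIwaniecActa1986, §13 p. 242] -/
theorem layAll_le (a : ℤ) {y P P' R₀ lam η : ℝ} (hy : 1 ≤ y) (hay : |(a : ℝ)| ≤ y) (hP : 0 < P)
    (hPP' : P ≤ P') (hP'2 : P' ≤ 2 * P) (hR₀ : 0 < R₀) (hη : 0 ≤ η) (hlam : 1 ≤ lam)
    (hlamη : lam ^ 2 - 1 ≤ 3 * η) {J : ℕ} (hJ : sHi a y P R₀ / lam ^ J < 1) {r : ℕ} (hr1 : R₀ < r)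
    (hr2 : (r : ℝ) ≤ lam * R₀) :
    layAll a y P P' R₀ lam J r ≤ 3 * lam * y * Real.log (2 * y) * (9 * η + 4 / P) / r := by
  have hy0 : 0 ≤ y := zero_le_one.trans hy
  have hlam0 : 0 < lam := by linarith
  have hr0 : (0 : ℝ) < r := hR₀.trans hr1
  have hlog0 : 0 ≤ Real.log (2 * y) := Real.log_nonneg (by linarith)
  set shi := sHi a y P R₀ with hshi
  have hshi0 : 0 ≤ shi := by
    rw [hshi, sHi]; refine div_nonneg ?_ (by positivity); linarith [le_abs_self (a : ℝ)]
  -- per `(j, s)` bound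
  have hcell : ∀ j : ℕ, ∀ s ∈ sCell shi lam j,
      layer a y P P' R₀ lam (sLow shi lam j) r s ≤ Real.log (2 * y) * (9 * η * P + 4) := by
    intro j s hs
    obtain ⟨hs1, hs2⟩ := mem_sCell_bounds hshi0 hlam0 hs
    have hS0 : 0 ≤ sLow shi lam j := by rw [sLow]; positivity
    exact layer_le a hy hP.le hPP' hP'2 hR₀.le hS0 hη hlam hlamη hr1 hr2 hs1 hs2
  calc layAll a y P P' R₀ lam J r
      ≤ ∑ j ∈ Finset.range J, ∑ s ∈ sCell shi lam j, Real.log (2 * y) * (9 * η * P + 4) := by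
        unfold layAll
        exact Finset.sum_le_sum fun j _ => Finset.sum_le_sum fun s hs => hcell j s hs
    _ = Real.log (2 * y) * (9 * η * P + 4) * ⌊shi⌋₊ := by
        simp only [Finset.sum_const, nsmul_eq_mul]
        rw [← sum_card_sCell_eq hshi0 hlam hJ, Finset.mul_sum]
        exact Finset.sum_congr rfl fun j _ => by ring
    _ ≤ Real.log (2 * y) * (9 * η * P + 4) * (3 * lam * y / (P * r)) := by
        refine mul_le_mul_of_nonneg_left ?_ (by positivity)
        calc (⌊shi⌋₊ : ℝ) ≤ shi := Nat.floor_le hshi0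
          _ = (2 * y - a) / (P * R₀) := by rw [hshi, sHi]
          _ ≤ (3 * y) / (P * R₀) := by
              refine div_le_div_of_nonneg_right ?_ (by positivity)
              linarith [neg_abs_le (a : ℝ)]
          _ ≤ 3 * lam * y / (P * r) := by
              rw [div_le_div_iff₀ (by positivity) (by positivity)]
              have : (r : ℝ) * (3 * y) ≤ (lam * R₀) * (3 * y) := mul_le_mul_of_nonneg_right hr2 (by positivity)
              nlinarith
    _ = 3 * lam * y * Real.log (2 * y) * (9 * η + 4 / P) / r := by
        field_simp

/-- A divisor-bound parameter for the shifts: `τ(n − a) ≤ D` on `(y, 2y]` whenever `τ(m) ≤ D` for all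
`1 ≤ m ≤ 3y` (`|a| ≤ y`). [folklore] -/
theorem sigma_shift_le_of {a : ℤ} {y D : ℝ} (hy : 0 ≤ y) (hay : |(a : ℝ)| ≤ y)
    (hD : ∀ m : ℕ, (m : ℝ) ≤ 3 * y → (σ 0 m : ℝ) ≤ D) :
    ∀ n ∈ Ioc ⌊y⌋₊ ⌊2 * y⌋₊, (σ 0 ((n : ℤ) - a).natAbs : ℝ) ≤ D := by
  intro n hn
  have hb := mem_Ioc_floor_bounds hy hn
  refine hD _ ?_
  have h1 : ((((n : ℤ) - a).natAbs : ℕ) : ℝ) = |((n : ℝ) - a)| := by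
    rw [Nat.cast_natAbs]; push_cast; rfl
  rw [h1]
  have := abs_sub (n : ℝ) (a : ℝ)
  have hn0 : |(n : ℝ)| = n := abs_of_nonneg (Nat.cast_nonneg _)
  linarith

/-- **The moduli not coprime to `a`, summed over the block**: for `r` in any set `Sr ⊆ [1, Rn]`,
`∑_{r} (E₁(r) + E₂(r)) ≤ (J + 1) D² ∑_{n ≤ 2y,(n,|a|)>1} Λ(n)`.
[cite: BombieriFriedlanderIwaniecActa1986, §16 p. 250] -/
theorem sum_eOne_add_eTwo_le {a : ℤ} {y D P P' R₀ lam : ℝ} (hy : 1 ≤ y) (hay : |(a : ℝ)| ≤ y)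
    {Rn : ℕ} {Sr : Finset ℕ} (hSr : Sr ⊆ Icc 1 Rn)
    (hD : ∀ n ∈ Ioc ⌊y⌋₊ ⌊2 * y⌋₊, (σ 0 ((n : ℤ) - a).natAbs : ℝ) ≤ D) (J : ℕ) :
    ∑ r ∈ Sr, (eOne a y P P' r + eTwo a y P P' R₀ lam J r) ≤
      ((J : ℝ) + 1) * (D ^ 2 * Literature.NumberTheory.Sieve.nonCoprimePart a.natAbs (2 * y)) := by
  set ncp := Literature.NumberTheory.Sieve.nonCoprimePart a.natAbs (2 * y) with hncp
  rw [Finset.sum_add_distrib]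
  have h1 : ∑ r ∈ Sr, eOne a y P P' r ≤ D ^ 2 * ncp := by
    unfold eOne
    have hsub : Ioc ⌊P⌋₊ ⌊P'⌋₊ ⊆ Icc 1 ⌊P'⌋₊ := fun q hq => by
      rw [Finset.mem_Ioc] at hq; rw [Finset.mem_Icc]; omega
    exact sum_sum_notCoprime_ivlCongr_le hy hay hsub hSr (fun _ => y) (fun _ => 2 * y) hD
  have h2 : ∑ r ∈ Sr, eTwo a y P P' R₀ lam J r ≤ J * (D ^ 2 * ncp) := by
    unfold eTwo
    rw [Finset.sum_comm]
    calc ∑ j ∈ Finset.range J, ∑ r ∈ Sr,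
          ∑ s ∈ (sCell (sHi a y P R₀) lam j).filter (fun s : ℕ => ¬ IsCoprime (s : ℤ) a),
            ivlCongr (s * r) a (cLo a y P R₀ lam (sLow (sHi a y P R₀) lam j))
              (cHi a y P' R₀ (sLow (sHi a y P R₀) lam j)) y
        ≤ ∑ j ∈ Finset.range J, D ^ 2 * ncp := by
          refine Finset.sum_le_sum fun j _ => ?_
          have hsub : sCell (sHi a y P R₀) lam j ⊆ Icc 1 ⌊sHi a y P R₀ / lam ^ j⌋₊ := fun s hs => by
            rw [sCell, Finset.mem_Ioc] at hs; rw [Finset.mem_Icc]; omega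
          exact sum_sum_notCoprime_ivlCongr_le hy hay hsub hSr (fun _ => _) (fun _ => _) hD
      _ = J * (D ^ 2 * ncp) := by rw [Finset.sum_const, Finset.card_range, nsmul_eq_mul]
  calc _ ≤ D ^ 2 * ncp + J * (D ^ 2 * ncp) := add_le_add h1 h2
    _ = ((J : ℝ) + 1) * (D ^ 2 * ncp) := by ring

end BFI

end Literature.NumberTheory.Sieve
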